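import Mathlib
import Summits.ResolutionOfSingularities.ResolutionOfSingularities.Theorems.RadicialJungCleanModelsCleanProp44SideFamilyGeneralExponents
import Summits.ResolutionOfSingularities.ResolutionOfSingularities.Theorems.RadicialJungCleanModelsCleanProp44NearLineOfCleanRegAt
import Literature.AlgebraicGeometry.Resolution.RsopLocalization
import HarnessLib

/-!
# Route `RadicialJung`, crux `CleanModels` (stmt-ResolutionOfSingularities-15917), line `Sketch` rev 35, stub 6 `stub_cleanProp44` (X44c):
# THE FIBRE OF THE EXCEPTIONAL DIVISOR OVER A POINT OF A CLEAN-PERMISSIBLE CURVE CENTRE IS CLEAN-PERMISSIBLE, UP TO BIRTHS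

Seat decomp-res-hand-2 g19 (structural hand).  Consumer form of ✓ `cleanPermissibleAt_exceptionalTrace_or_birth_general` (`…CleanProp44SideFamilyGeneralExponents.lean`)
for the `l = 1` successor analysis of the curve slice (R3ᵐⁱⁿ′) (`Cruxes/CleanModels/Lines/Sketch-memo-hand2-g18-stubs-5-7.md` §2 (a) (v)): the input is the
predicate `CleanPermissibleAt` ITSELF (both of its forms), not a chosen normal form.  Setting: `τ : X' → X` a blowing up along `J` (`IsBlowup`), `x' ∈ X'`
with `dim 𝒪_{X',x'} = 3` over `x = τ x'` with `dim 𝒪_{X,x} = 3`, the centre a REGULAR CURVE at `x` (`J_x = (c₀, c₁)` for a pair `c` which is part of a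
regular system of parameters) and the line of `G` CLEAN-PERMISSIBLE at `x` for `J_x`.  The fibre `E_x = τ⁻¹(x)` has stalk ideal `𝔪_x 𝒪_{X',x'}` at `x'`.

* `map_maximalIdeal_eq_span_pair_of_curveCentre` — `𝔪_x 𝒪_{X',x'} = (e', τ^♯ w)` with `(e') = J_x 𝒪_{X',x'}` and `w` the transversal parameter of
  any clean-permissible presentation; `(e', τ^♯ w)` is part of a regular system of parameters (the fibre is a regular curve germ through `x'`).
* `cleanPermissibleAt_exceptionalFibre_or_birth` — **the line of `τ^♯ G` is clean-permissible at `x'` for the fibre `𝔪_x 𝒪_{X',x'}`, OR `x'` is a BIRTH of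
  the fibre**: some non-trivial representative reads `U · D^p` with `U` a unit of `𝒪_{X',x'}` failing the three-way non-birth test for `𝔪_x 𝒪_{X',x'}`
  (`Ū ∈ κ(x')^p`, no `U - c'^p ∈ 𝔪` transversal to the fibre, none a minimal generator of its ideal).  No corner, no tangency — whatever the clean
  components through `x`.  (Form (1) at `x`: ✓ `…exceptionalTrace_or_birth_general`; form (2) at `x`: the unit pulls back to a unit and
  ✓ `cleanPermissibleAt_of_unit_rep` applies — its residue may become a `p`-th power only in an inseparable residue extension `κ(x')/κ(x)`, memo 4e (B5′).)

Honest framing: OURS, bookkeeping; a TOOL for the (R3ᵐⁱⁿ′) prover ([CoP1] Lemma 4.3 (4): over a `τ = 1` point of the curve the near point is unique, so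
the fibre matters as a CENTRE only through its births).  Nothing here proves X44c, any case of `CleanModels`, or resolution of singularities in
characteristic `p`.  Setting only: [cite: CossartPiltant2008, Lemma 4.3 (4)–(5); Prop. 4.4 (proof)] [cite: Piltant2013, §2 Axiom 4]
[cite: GortzWedhorn2020, Prop. 13.91] [cite: Matsumura1987, Thm. 14.2].
-/

noncomputable section

set_option linter.dupNamespace false -- mandated namespace of this single-conjunct summit

open IsLocalRing CategoryTheory AlgebraicGeometry
open Literature.AlgebraicGeometry.Resolution Literature.AlgebraicGeometry.Motives

namespace Summit.ResolutionOfSingularities.ResolutionOfSingularities.Theorems.RadicialJung.CleanModels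

universe u

section Scheme

variable {p : ℕ} {X X' : Scheme.{u}} [IsIntegral X] [IsIntegral X'] {τ : X' ⟶ X} [IsDominant τ] {J : X.IdealSheafData}

omit [IsIntegral X] [IsIntegral X'] [IsDominant τ] in
set_option maxHeartbeats 800000 in
-- stalk-level bookkeeping
/-- **The fibre of the exceptional divisor over a point of a curve centre.**  For `τ : X' → X` a blowing up along `J`, `x' ∈ X'` over `x`, a regular
system of parameters `(c, w)` of `𝒪_{X,x}` with `c : Fin 2`, `w : Fin 1` and `(c) = J_x`: there is `e'` with `(e') = J_x 𝒪_{X',x'}`,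
`𝔪_x 𝒪_{X',x'} = (e', τ^♯ w₀)`, and `(e', τ^♯ w₀)` part of a regular system of parameters of `𝒪_{X',x'}`. [cite: GortzWedhorn2020, Prop. 13.91]
[cite: CossartPiltant2008, Lemma 4.3 (4)] -/
theorem map_maximalIdeal_eq_span_pair_of_curveCentre (hτ : IsBlowup τ J) (x' : X') (hR : IsRegularLocalRing (X.presheaf.stalk (τ x')))
    (c : Fin 2 → X.presheaf.stalk (τ x')) (w : Fin 1 → X.presheaf.stalk (τ x'))
    (hz : Ideal.span (Set.range (Fin.append c w)) = maximalIdeal (X.presheaf.stalk (τ x')))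
    (hdim : ringKrullDim (X.presheaf.stalk (τ x')) = ((2 + 1 : ℕ) : WithBot ℕ∞)) (hcJ : Ideal.span (Set.range c) = stalkIdeal J (τ x')) :
    ∃ e' : X'.presheaf.stalk x', Ideal.span {e'} = (stalkIdeal J (τ x')).map (τ.stalkMap x').hom ∧
      (maximalIdeal (X.presheaf.stalk (τ x'))).map (τ.stalkMap x').hom = Ideal.span ({e', (τ.stalkMap x').hom (w 0)} : Set (X'.presheaf.stalk x')) ∧
      IsRsopPart ![e', (τ.stalkMap x').hom (w 0)] := by
  classical
  obtain ⟨i, uf, m, jJ, hrel, -, -, -, -, hrsop, -⟩ :=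
    exists_transform_normalForm_of_isBlowup hτ x' hR c w hz hdim hcJ (fun _ => 0) (fun _ => 0) isUnit_one
  have he' : Ideal.span {(τ.stalkMap x').hom (c i)} = (stalkIdeal J (τ x')).map (τ.stalkMap x').hom := by
    rw [← hcJ]; exact span_singleton_eq_map_span_of_rel _ c i uf hrel
  refine ⟨(τ.stalkMap x').hom (c i), he', ?_, ?_⟩
  · apply le_antisymm
    · rw [← hz, Ideal.map_span, Ideal.span_le]
      rintro _ ⟨_, ⟨k, rfl⟩, rfl⟩
      induction k using Fin.addCases with
      | left j =>
        rw [Fin.append_left, SetLike.mem_coe, hrel j]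
        exact Ideal.mul_mem_right _ _ (Ideal.subset_span (by simp))
      | right j =>
        rw [Fin.append_right, SetLike.mem_coe]
        have hj : j = 0 := Subsingleton.elim j 0
        subst hj
        exact Ideal.subset_span (by simp)
    · rw [Ideal.span_le, Set.insert_subset_iff, Set.singleton_subset_iff]
      refine ⟨Ideal.mem_map_of_mem _ (hz ▸ Ideal.subset_span ⟨Fin.castAdd 1 i, Fin.append_left c w i⟩),
        Ideal.mem_map_of_mem _ (hz ▸ Ideal.subset_span ⟨Fin.natAdd 2 0, Fin.append_right c w 0⟩)⟩
  · have hinj : Function.Injective (![0, Fin.succ (Fin.natAdd m 0)] : Fin 2 → Fin (m + 1 + 1)) := by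
      intro t₁ t₂ h
      fin_cases t₁ <;> fin_cases t₂
      · rfl
      · exfalso
        simp only [Fin.zero_eta, Fin.mk_one, Matrix.cons_val_zero, Matrix.cons_val_one] at h
        exact Fin.succ_ne_zero _ h.symm
      · exfalso
        simp only [Fin.zero_eta, Fin.mk_one, Matrix.cons_val_zero, Matrix.cons_val_one] at h
        exact Fin.succ_ne_zero _ h
      · rfl
    have h1 := hrsop.comp _ hinj
    have h2 : (Fin.cons ((τ.stalkMap x').hom (c i)) (Fin.append (fun q => uf (jJ q).1) fun m' => (τ.stalkMap x').hom (w m')) :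
        Fin (m + 1 + 1) → X'.presheaf.stalk x') ∘ (![0, Fin.succ (Fin.natAdd m 0)] : Fin 2 → Fin (m + 1 + 1)) =
        ![(τ.stalkMap x').hom (c i), (τ.stalkMap x').hom (w 0)] := by
      funext t
      fin_cases t
      · rfl
      · simp only [Function.comp_apply, Fin.mk_one, Matrix.cons_val_one, Matrix.cons_val_zero, Fin.cons_succ, Fin.append_right]
    rwa [h2] at h1

set_option maxHeartbeats 1600000 in
-- unpacking `CleanPermissibleAt`, two forms
/-- **THE FIBRE OF THE EXCEPTIONAL DIVISOR OVER A POINT OF A CLEAN-PERMISSIBLE REGULAR CURVE CENTRE IS CLEAN-PERMISSIBLE, OR THE POINT IS A BIRTH.**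
See the module docstring. [cite: CossartPiltant2008, Lemma 4.3 (4)–(5); Prop. 4.4 (proof)] [cite: Piltant2013, §2 Axiom 4] -/
theorem cleanPermissibleAt_exceptionalFibre_or_birth [Fact p.Prime] [CharP X'.functionField p] (hτ : IsBlowup τ J) (x' : X')
    (hdim3 : ringKrullDim (X.presheaf.stalk (τ x')) = 3)
    (hcurve : ∃ c : Fin 2 → X.presheaf.stalk (τ x'), IsRsopPart c ∧ Ideal.span (Set.range c) = stalkIdeal J (τ x'))
    {G : X.functionField} (hperm : CleanPermissibleAt p (RatFn.toFunctionField (τ x')) G (stalkIdeal J (τ x')))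
    (hdim' : ringKrullDim (X'.presheaf.stalk x') = 3) :
    CleanPermissibleAt p (RatFn.toFunctionField x') (RatFn.functionFieldMap τ G)
        ((maximalIdeal (X.presheaf.stalk (τ x'))).map (τ.stalkMap x').hom) ∨
    ∃ (cc : Fin p → X'.functionField) (U D : X'.presheaf.stalk x'), (∃ j : Fin p, (j : ℕ) ≠ 0 ∧ cc j ≠ 0) ∧ IsUnit U ∧ D ≠ 0 ∧
      (∑ j : Fin p, cc j ^ p * RatFn.functionFieldMap τ G ^ (j : ℕ)) = RatFn.toFunctionField x' (U * D ^ p) ∧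
      ¬ ((∀ c' : X'.presheaf.stalk x', U - c' ^ p ∉ maximalIdeal (X'.presheaf.stalk x')) ∨
          (∃ c' : X'.presheaf.stalk x', U - c' ^ p ∈ maximalIdeal (X'.presheaf.stalk x') ∧
            U - c' ^ p ∉ (maximalIdeal (X.presheaf.stalk (τ x'))).map (τ.stalkMap x').hom ⊔ maximalIdeal (X'.presheaf.stalk x') ^ 2) ∨
          (∃ c' : X'.presheaf.stalk x', U - c' ^ p ∈ (maximalIdeal (X.presheaf.stalk (τ x'))).map (τ.stalkMap x').hom ∧
            U - c' ^ p ∉ maximalIdeal (X'.presheaf.stalk x') ^ 2)) := by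
  classical
  obtain ⟨hR, n, l, c, w, hz, hdimnl, hcJ, cc, hcc, hform⟩ := hperm
  obtain ⟨c₂, hc₂, hc₂J⟩ := hcurve
  -- the centre is a curve: `n = 2`, `l = 1`
  have hn : n = 2 := by
    have h1 := (isRsopPart_append_of_span_range_append hR c w hz hdimnl).append_left.height_span_range
    have h2 := hc₂.height_span_range
    rw [hcJ] at h1
    rw [hc₂J, h1] at h2
    exact_mod_cast h2
  subst hn
  have hl : l = 1 := by
    have h1 := hdimnl.symm.trans hdim3
    have h2 : (2 + l : ℕ) = 3 := by exact_mod_cast h1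
    omega
  subst hl
  -- the fibre through `x'`
  obtain ⟨e', he', hfib, hpair⟩ := map_maximalIdeal_eq_span_pair_of_curveCentre hτ x' hR c w hz hdimnl hcJ
  have hR' : IsRegularLocalRing (X'.presheaf.stalk x') := hpair.isRegularLocalRing
  haveI := isDomain_of_isRegularLocalRing (X'.presheaf.stalk x')
  have he'0 : e' ≠ 0 := by simpa using hpair.ne_zero 0
  obtain ⟨z', hzz⟩ := exists_span_triple_eq_of_isRsopPart_pair hpair hdim'
  rw [hfib]
  rcases hform with ⟨a, b, u, hu, -, hrep⟩ | ⟨u, hu, hrep, -⟩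
  · -- form (1) at `x`: the trace theorem with arbitrary exponents
    rcases cleanPermissibleAt_exceptionalTrace_or_birth_general hτ x' hR c w hz hdimnl hcJ hcc hu hrep hdim' 0 he' hzz with
      h | ⟨hA, -, -, U, D, hU, hD, hrepU, hnb⟩
    · exact Or.inl h
    · right
      refine ⟨fun j => RatFn.functionFieldMap τ (cc j), U, e' ^ ((∑ k, a k) / p) * D, ?_, hU,
        mul_ne_zero (pow_ne_zero _ he'0) hD, ?_, hnb⟩
      · obtain ⟨j, hj, hcj⟩ := hcc
        exact ⟨j, hj, (map_ne_zero _).mpr hcj⟩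
      · rw [hrepU, mul_pow, ← pow_mul, Nat.div_mul_cancel hA, mul_assoc]
  · -- form (2) at `x`: the unit pulls back to a unit
    obtain ⟨hcc', hrep'⟩ := rep_functionFieldMap x' hcc hrep
    have hU : IsUnit ((τ.stalkMap x').hom u) := hu.map _
    by_cases hnb : (∀ c' : X'.presheaf.stalk x', (τ.stalkMap x').hom u - c' ^ p ∉ maximalIdeal (X'.presheaf.stalk x')) ∨
        (∃ c' : X'.presheaf.stalk x', (τ.stalkMap x').hom u - c' ^ p ∈ maximalIdeal (X'.presheaf.stalk x') ∧
          (τ.stalkMap x').hom u - c' ^ p ∉ Ideal.span ({e', (τ.stalkMap x').hom (w 0)} : Set (X'.presheaf.stalk x')) ⊔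
            maximalIdeal (X'.presheaf.stalk x') ^ 2) ∨
        (∃ c' : X'.presheaf.stalk x', (τ.stalkMap x').hom u - c' ^ p ∈ Ideal.span ({e', (τ.stalkMap x').hom (w 0)} : Set (X'.presheaf.stalk x')) ∧
          (τ.stalkMap x').hom u - c' ^ p ∉ maximalIdeal (X'.presheaf.stalk x') ^ 2)
    · left
      have hrep1 : (∑ j : Fin p, RatFn.functionFieldMap τ (cc j) ^ p * RatFn.functionFieldMap τ G ^ (j : ℕ)) =
          RatFn.toFunctionField x' ((τ.stalkMap x').hom u) * (1 : X'.functionField) ^ p := by rw [hrep', one_pow, mul_one]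
      exact cleanPermissibleAt_of_unit_rep (RatFn.toFunctionField x') hR' hdim' hzz _ hcc' hU one_ne_zero hrep1 hnb
    · right
      refine ⟨fun j => RatFn.functionFieldMap τ (cc j), (τ.stalkMap x').hom u, 1, hcc', hU, one_ne_zero, ?_, hnb⟩
      rw [hrep', one_pow, mul_one]

end Scheme

end Summit.ResolutionOfSingularities.ResolutionOfSingularities.Theorems.RadicialJung.CleanModels

end
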